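import Literature.NumberTheory.GelbartRogawski1991.LocalScaleModelTransport
import Literature.NumberTheory.GelbartRogawski1991.LocalDoubledGaloisConjSiegel
import Literature.NumberTheory.Automorphic.UnitaryGroupLocalCongr
import Literature.NumberTheory.Automorphic.UnitaryGroupDualPairLocalLine
import HarnessLib

/-!
# The retyping `k ↦ k ⊗ 1_W` of the rank-one dual pair commutes with the scale retyping, the Galois conjugation and the rational congruences

Topic `NumberTheory/Automorphic` + `GelbartRogawski1991`; namespace `Literature.NumberTheory.GelbartRogawski1991.UnitaryDualPair.LocalSplitting`.  KERNEL ONLY: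
theorems; no definition, no named fact, no `sorry`.  Cell `hodgecm-mathlib` (D-0151), programme P5 (crux HLiu418 = stmt-HodgeConjecture-24832), GLUE for the assembler's
step 1 of the road card `F0/P5/A-p18/g23/ROAD-L4if-v3.A-p18g23.md` §8 (A-p18 (g23), 2026-09-01): the members of [Liu2021, App. D]'s indexed family act through
★ `localLineInl E c N e J_V J_{W_a} v : U(J_V)(F_v) →* U(J_V ⊗ J_{W_a})(F_v)` (`k ↦ reindex e (k ⊗ 1)`), while the transport identities ★ (C1)-rep … (C4b) speak the
retypings ★ `scaleInl` (`U(T)(F_v) →* U(aT)(F_v)`), ★ `localPiGalConj` (`bar`) and ★ `localCongr` (`Ad(B)`) of the PAIR group.  At the level of matrices `k ⊗ 1_W`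
is `k` relabelled, so:
* (`scaleInl (localLineInl_{a₁} k) = localLineInl_{a₂} k` is ★ `scaleInl_localLineInl` of `LocalSplittingCMGaloisTransportUndoubled` — not repeated here);
* `localPiGalConj_localLineInl`: `bar (localLineInl k) = localLineInl (bar k)` (entrywise conjugation commutes with `⊗ 1` and `reindex`);
* `localCongr_reindex_kronecker_localLineInl`: `Ad(reindex e (B ⊗ 1)) (localLineInl k) = localLineInl (Ad(B) k)` for a rational similitude `B` of `J_V`
  (`formCongr_reindex_kronecker_one`: `reindex e (B ⊗ 1)` is a similitude of `reindex e (J_V ⊗ J_W)` with the same multiplier).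
[MoeglinVignerasWaldspurger1987, Chap. 1 I.17]; [PlatonovRapinchuk1994, §2.3].  Nothing of the cited sources is asserted; HC_CM is proved only modulo the
printed citations until rung 0 closes.
-/

set_option autoImplicit false

noncomputable section

open scoped Matrix Kronecker
open NumberField IsDedekindDomain Matrix
open Literature.NumberTheory.Automorphic Literature.NumberTheory.Automorphic.UnitaryGroup

namespace Literature.NumberTheory.GelbartRogawski1991.UnitaryDualPair.LocalSplitting

variable (F E : Type) [Field F] [NumberField F] [Field E] [NumberField E] [Algebra F E] (c : E ≃ₐ[F] E) (N : ℕ) {n : ℕ}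
  (e : Fin N × Fin 1 ≃ Fin n) {TV : Matrix (Fin N) (Fin N) F} {JV : Matrix (Fin N) (Fin N) E} (hJV : JV = TV.map (algebraMap F E))
  (v : HeightOneSpectrum (𝓞 F))

/-! ## §1 `bar ∘ localLineInl = localLineInl ∘ bar` -/

/-- **`bar (k ⊗ 1_W) = (bar k) ⊗ 1_W`** for rational `J_V`, `J_W`: the Galois conjugation of the pair group is compatible with `k ↦ k ⊗ 1`.
[cite: MoeglinVignerasWaldspurger1987, Chap. 1 I.17] [cite: CasselsFrohlichANT1967, Ch. II §10] -/
theorem localPiGalConj_localLineInl {TW : Matrix (Fin 1) (Fin 1) F} {JW : Matrix (Fin 1) (Fin 1) E} (hJW : JW = TW.map (algebraMap F E))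
    (k : localPi E c N JV v) :
    localPiGalConj E c n v (reindex_kronecker_eq_gram_map F E e hJV hJW) (localLineInl E c N e JV JW v k) =
      localLineInl E c N e JV JW v (localPiGalConj E c N v hJV k) := by
  refine Subtype.ext (funext fun w => Units.ext ?_)
  rw [coe_localPiGalConj_apply F E c v (reindex_kronecker_eq_gram_map F E e hJV hJW), coe_localLineInl, coe_localLineInl, coe_localLineGL_apply,
    coe_localLineGL_apply, coe_localPiGalConj_apply F E c v hJV, Matrix.reindex_apply, Matrix.reindex_apply, ← Matrix.submatrix_map,
    ← kronecker_map_map, Matrix.map_one _ (map_zero _) (map_one _)]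

/-! ## §2 `Ad(reindex e (B ⊗ 1)) ∘ localLineInl = localLineInl ∘ Ad(B)` -/

section Congr

variable {JV' : Matrix (Fin N) (Fin N) E} (JW : Matrix (Fin 1) (Fin 1) E) (B : GL (Fin N) E) {b : E} (hb : b ≠ 0)
  (hB : formCongr (c : E →+* E) B (b • JV) = JV')

omit [NumberField F] [NumberField E] in
include hB in
/-- **`reindex e (B ⊗ 1)` is a similitude of the pair form with the same multiplier**: `ᵗ(c B̃) (b • reindex e (J_V ⊗ J_W)) B̃ = reindex e (J_V′ ⊗ J_W)`.
[cite: PlatonovRapinchuk1994, §2.3] [cite: MoeglinVignerasWaldspurger1987, Chap. 1 I.17] -/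
theorem formCongr_reindex_kronecker_one :
    formCongr (c : E →+* E) (UnitaryGroup.reindexGL e (kroneckerGL (B, 1))) (b • Matrix.reindex e e (JV ⊗ₖ JW)) = Matrix.reindex e e (JV' ⊗ₖ JW) := by
  have h1 : b • Matrix.reindex e e (JV ⊗ₖ JW) = Matrix.reindex e e ((b • JV) ⊗ₖ JW) := by
    ext i j
    simp only [Matrix.reindex_apply, Matrix.smul_apply, Matrix.submatrix_apply, Matrix.kroneckerMap_apply, smul_eq_mul, mul_assoc]
  rw [h1, ← hB, formCongr, formCongr, UnitaryGroup.coe_reindexGL, coe_kroneckerGL, Units.val_one, Matrix.reindex_apply, Matrix.reindex_apply, Matrix.reindex_apply,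
    ← Matrix.submatrix_map, ← kronecker_map_map, Matrix.map_one _ (map_zero _) (map_one _), Matrix.transpose_submatrix, ← Matrix.kroneckerMap_transpose,
    Matrix.transpose_one, Matrix.submatrix_mul_equiv, Matrix.submatrix_mul_equiv, ← Matrix.mul_kronecker_mul, ← Matrix.mul_kronecker_mul, Matrix.one_mul,
    Matrix.mul_one]

omit [NumberField F] [NumberField E] in
/-- the matrix of `(reindex e (B ⊗ 1))` read over a ring `S`: `reindex e (B_S ⊗ 1)`. [cite: PlatonovRapinchuk1994, §5.1] -/
private theorem coe_map_reindexGL_kroneckerGL_one {S : Type*} [CommRing S] (f : E →+* S) (B₀ : GL (Fin N) E) :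
    ((Matrix.GeneralLinearGroup.map f (UnitaryGroup.reindexGL e (kroneckerGL (B₀, 1))) : GL (Fin n) S) : Matrix (Fin n) (Fin n) S) =
      Matrix.reindex e e (((Matrix.GeneralLinearGroup.map f B₀ : GL (Fin N) S) : Matrix (Fin N) (Fin N) S) ⊗ₖ (1 : Matrix (Fin 1) (Fin 1) S)) := by
  change ((UnitaryGroup.reindexGL e (kroneckerGL (B₀, 1)) : GL (Fin n) E) : Matrix (Fin n) (Fin n) E).map f = _
  rw [UnitaryGroup.coe_reindexGL, coe_kroneckerGL, Units.val_one, Matrix.reindex_apply, Matrix.reindex_apply, ← Matrix.submatrix_map, ← kronecker_map_map,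
    Matrix.map_one _ (map_zero _) (map_one _)]
  rfl

include hB in
/-- **`Ad(reindex e (B ⊗ 1)) (k ⊗ 1_W) = (Ad(B) k) ⊗ 1_W`**: the local congruence of the pair group along the Kronecker similitude is compatible with `k ↦ k ⊗ 1`.
[cite: PlatonovRapinchuk1994, §2.3] [cite: MoeglinVignerasWaldspurger1987, Chap. 1 I.17] -/
theorem localCongr_reindex_kronecker_localLineInl (k : localPi E c N JV' v) :
    localCongr E c (UnitaryGroup.reindexGL e (kroneckerGL (B, 1))) hb (formCongr_reindex_kronecker_one F E c N e JW B hB) v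
        (localLineInl E c N e JV' JW v k) =
      localLineInl E c N e JV JW v (localCongr E c B hb hB v k) := by
  refine Subtype.ext (funext fun w => Units.ext ?_)
  rw [coe_localCongr_apply_apply, coe_localLineInl, coe_localLineInl, Units.val_mul, Units.val_mul, coe_localLineGL_apply, coe_localLineGL_apply,
    coe_localCongr_apply_apply, Units.val_mul, Units.val_mul, ← map_inv, ← map_inv, ← map_inv, ← map_inv, Prod.inv_mk, inv_one,
    coe_map_reindexGL_kroneckerGL_one E N e _ B, coe_map_reindexGL_kroneckerGL_one E N e _ B⁻¹, Matrix.reindex_apply, Matrix.reindex_apply, Matrix.reindex_apply,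
    Matrix.submatrix_mul_equiv, Matrix.submatrix_mul_equiv, ← Matrix.mul_kronecker_mul, ← Matrix.mul_kronecker_mul, Matrix.one_mul, Matrix.one_mul]
  rfl

end Congr

end Literature.NumberTheory.GelbartRogawski1991.UnitaryDualPair.LocalSplitting

end
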